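import Mathlib
import HarnessLib
import Literature.Probability.MarkovChains.CheegerInequality

/-!
# The variational characterisation of the spectral gap, `γ = 1 − λ₂ = min{𝓔(f) : f ⊥_π 1, ‖f‖_π = 1}` (Levin–Peres–Wilmer Lemma 13.7), and Theorem 13.10 as printed

HONEST FRAMING: exact (Metropolis-corrected) sampling algorithms for lattice gauge theory; figures
of merit are autocorrelation/cost numbers at stated couplings and volumes; no continuum-physics claim.

Conventions of `PeskunOrdering.lean` (`piInner π g h = ⟨g,h⟩_π`, `dirichletForm π P f = 𝓔(f)`,
`dirichletForm_eq` = Lemma 13.6 `𝓔(f) = ⟨f,f⟩_π − ⟨f,Pf⟩_π = ⟨(I−P)f,f⟩_π`, `piInner_mulVec_comm` =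
self-adjointness of a reversible `P` in `ℓ²(π)`, `spectralGapR π P = Gap_R = inf{𝓔(f) : f ⊥_π 1,
‖f‖_π = 1}`), `BottleneckRatio.lean` (`Φ⋆`), `BottleneckRatioSpectralGap.lean` (`Gap_R ≤ 2Φ⋆`) and
`CheegerInequality.lean` (`Φ⋆²/2 ≤ Gap_R`).  Source: D. A. Levin, Y. Peres (with E. L. Wilmer),
*Markov Chains and Mixing Times*, 2nd ed., AMS 2017 [LevinPeres2017], §12.1–12.2 and §13.2.1.
Everything is PROVED (0 named facts).  Setting of this file: `X` finite with AT LEAST TWO POINTS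
(`[Nontrivial X]`, so that `f ⊥_π 1, f ≢ 0` is possible), `π` a POSITIVE probability vector, `P`
row-stochastic and REVERSIBLE with respect to `π` (`DetailedBalance π P`), as in Lemma 13.7.

* `orthEigenvalues π P` — the eigenvalues `λ` of `P` ("`Pf = λf`", §12.1) carried by a real
  eigenfunction `f ≢ 0` with `f ⊥_π 1`; `secondEigenvalue π P = λ₂ := max orthEigenvalues` and
  `spectralGap π P = γ := 1 − λ₂` [cite: LevinPeres2017, §12.2 eq. (12.7) and "`γ := 1 − λ₂`";
  §13.2.1 proof of Lemma 13.7 ("`{f_k}` is an orthonormal basis … We can and will always take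
  `f₁ = 1`", so that `λ₂ = max_{j ≥ 2} λ_j` is the largest eigenvalue with an eigenfunction
  `⊥_π 1`)].  DESIGN NOTE: the book labels the (real) eigenvalues of a reversible `P` with
  multiplicity, `1 = λ₁ > λ₂ ≥ ⋯` (12.7), via the spectral theorem (Lemma 12.2); the definition here
  names `λ₂` directly as the top of the spectrum on `1^⊥` — the quantity the proof of Lemma 13.7
  works with — and the theorems below show WITHOUT the spectral theorem that this maximum exists and
  is attained (for an irreducible `P` it is the second entry of (12.7); in general it is the second
  entry of the list with `f₁ = 1`).  Junk value `sSup ∅ = 0` on a one-point space.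
* `exists_isMinOn_dirichletForm` — the infimum defining `Gap_R` is ATTAINED (compactness of the
  constraint set `{f ⊥_π 1, ‖f‖_π = 1}` for `π > 0`) [cite: LevinPeres2017, §13.2.1 Lemma 13.7
  eq. (13.3) ("`γ = min …`": a minimum)]; `mulVec_eq_smul_of_isMinOn` — a minimiser `g` is an
  EIGENFUNCTION, `Pg = (1 − 𝓔(g))g` (first-order condition: `t ↦ 𝓔(g + th) − 𝓔(g)‖g + th‖²_π ≥ 0`
  vanishes at `t = 0`, so its linear coefficient `2⟨(I−P)g − 𝓔(g)g, h⟩_π` is `0` for every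
  `h ⊥_π 1`, and also for `h = 1` by stationarity; self-adjointness of `P` (reversibility) makes the
  coefficient this inner product) [cite: LevinPeres2017, §13.2.1 Lemma 13.7 (proof: the minimum in
  (13.3) is `1 − λ₂`, attained at the eigenfunction `f₂`)];
* `dirichletForm_eq_of_eigen` (`𝓔(f) = (1 − λ)‖f‖²_π` for `Pf = λf`), `le_of_mem_orthEigenvalues`
  (every `λ ∈ orthEigenvalues` has `λ ≤ 1 − Gap_R`: "`⟨(I−P)f,f⟩_π = Σ_{j≥2} a_j²(1−λ_j) ≥ 1 − λ₂`"
  read backwards), `isGreatest_orthEigenvalues` (`1 − Gap_R` IS the largest such eigenvalue);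
* **LEMMA 13.7** `LevinPeres2017_lemma_13_7`: **`γ = 1 − λ₂ = Gap_R = min{𝓔(f) : f ⊥_π 1,
  ‖f‖_π = 1}`** (`spectralGap π P = spectralGapR π P`, with `LevinPeres2017_lemma_13_7_isLeast`: the
  infimum is a minimum), the second form `LevinPeres2017_lemma_13_7_rayleigh` (`γ‖f‖²_π ≤ 𝓔(f)`
  for every `f ⊥_π 1`, equality attained: `exists_eigenfunction_spectralGap`) and **Remark 13.8**
  `LevinPeres2017_remark_13_8` (`γ·Var_π(f) ≤ 𝓔(f)` for every `f`)
  [cite: LevinPeres2017, §13.2.1 Lemma 13.7 eq. (13.3); Remark 13.8];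
* **THEOREM 13.10 (Sinclair–Jerrum 1989, Lawler–Sokal 1988) AS PRINTED** `LevinPeres2017_thm_13_10`:
  for a reversible `P` (positive stationary `π`, `|X| ≥ 2`), with `λ₂`, `γ = 1 − λ₂` as above,
  **`Φ⋆²/2 ≤ γ ≤ 2Φ⋆`** [cite: LevinPeres2017, §13.2.2 Thm 13.10 eq. (13.6)] — Lemma 13.7 applied to
  `CheegerInequality.LevinPeres2017_thm_13_10_lower` and
  `BottleneckRatioSpectralGap.LevinPeres2017_thm_13_10_upper`.

Not here: the full spectral decomposition (Lemma 12.2), `λ⋆`/`t_rel` versions (see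
`RelaxationTime.lean`), Theorem 12.4.
-/

namespace Literature.Probability.MarkovChains

open Finset Matrix

variable {X : Type*} [Fintype X] [DecidableEq X]

omit [DecidableEq X] in
/-- `(M v)_x = Σ_y M x y v_y`. [folklore] -/
private theorem mulVec_apply'' (M : Matrix X X ℝ) (v : X → ℝ) (x : X) :
    (M *ᵥ v) x = ∑ y, M x y * v y := rfl

/-! ## `λ₂` and `γ` -/

omit [DecidableEq X] in
/-- The eigenvalues of `P` carried by a real eigenfunction `f ≢ 0` orthogonal to the constants in
`ℓ²(π)` (`⟨f, 1⟩_π = Σ_x π(x)f(x) = 0`, `Pf = λf`). [cite: LevinPeres2017, §12.1 ("a function `f` on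
`X` is an eigenfunction with corresponding eigenvalue `λ` if `Pf = λf`") with §13.2.1 (`f ⊥_π 1`)] -/
def orthEigenvalues (π : X → ℝ) (P : Matrix X X ℝ) : Set ℝ :=
  {lam | ∃ f : X → ℝ, f ≠ 0 ∧ ∑ x, π x * f x = 0 ∧ P *ᵥ f = lam • f}

omit [DecidableEq X] in
/-- `λ₂`: the largest eigenvalue of `P` with an eigenfunction `⊥_π 1` — for a reversible `P` the
second entry of the ordered list `1 = λ₁ ≥ λ₂ ≥ ⋯ ≥ λ_|X| ≥ −1` of (12.7) taken with `f₁ = 1`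
(junk value `0` when no such eigenvalue exists, i.e. on a one-point space).
[cite: LevinPeres2017, §12.2 eq. (12.7); §13.2.1 proof of Lemma 13.7 ("We can and will always take
`f₁ = 1`")] -/
noncomputable def secondEigenvalue (π : X → ℝ) (P : Matrix X X ℝ) : ℝ := sSup (orthEigenvalues π P)

omit [DecidableEq X] in
/-- The SPECTRAL GAP `γ := 1 − λ₂` of a reversible chain. [cite: LevinPeres2017, §12.2 ("The spectral
gap of a reversible chain is defined by `γ := 1 − λ₂`")] -/
noncomputable def spectralGap (π : X → ℝ) (P : Matrix X X ℝ) : ℝ := 1 - secondEigenvalue π P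

/-! ## The constraint set `{f ⊥_π 1, ‖f‖_π = 1}` is compact and nonempty; the minimum is attained -/

omit [DecidableEq X] in
/-- On a space with two points, a positive probability vector gives some singleton mass `≤ ½`
(so `Φ⋆` is a genuine minimum and `{f ⊥_π 1, ‖f‖_π = 1} ≠ ∅`). [folklore] -/
private theorem exists_mass_le_half [Nontrivial X] {π : X → ℝ} (hπ : ∀ x, 0 < π x)
    (hπ1 : ∑ x, π x = 1) : ∃ S : Finset X, 0 < ∑ x ∈ S, π x ∧ ∑ x ∈ S, π x ≤ 1 / 2 := by
  classical
  obtain ⟨a, b, hab⟩ := exists_pair_ne X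
  by_cases ha : π a ≤ 1 / 2
  · exact ⟨{a}, by rw [sum_singleton]; exact hπ a, by rw [sum_singleton]; exact ha⟩
  · refine ⟨{b}, by rw [sum_singleton]; exact hπ b, ?_⟩
    rw [sum_singleton]
    have h2 : π a + π b ≤ ∑ x, π x := by
      rw [← sum_pair hab]
      exact sum_le_sum_of_subset_of_nonneg (subset_univ _) fun x _ _ => (hπ x).le
    rw [hπ1] at h2
    rw [not_le] at ha
    linarith

/-- The normalised test function `f_S/‖f_S‖_π` is admissible: if some set has `0 < π(S) ≤ ½` then
`{f : f ⊥_π 1, ‖f‖_π = 1}` is nonempty. [cite: LevinPeres2017, §13.2.1 proof of Lemma 13.7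
("`f̃ := f/‖f‖₂` satisfies `‖f̃‖₂ = 1`") with §13.2.2 (the test function `f_S`, `E_π(f_S) = 0`)] -/
theorem exists_mean_zero_piInner_one {π : X → ℝ} (hπ1 : ∑ x, π x = 1)
    (hX : ∃ S : Finset X, 0 < ∑ x ∈ S, π x ∧ ∑ x ∈ S, π x ≤ 1 / 2) :
    ∃ g : X → ℝ, ∑ x, π x * g x = 0 ∧ piInner π g g = 1 := by
  obtain ⟨S, hS0, hS⟩ := hX
  have hSc : 1 / 2 ≤ ∑ x ∈ Sᶜ, π x := by
    have := sum_add_sum_compl S π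
    rw [hπ1] at this
    linarith
  set V : ℝ := (∑ x ∈ S, π x) * ∑ x ∈ Sᶜ, π x with hV
  have hVpos : 0 < V := mul_pos hS0 (by linarith)
  set c : ℝ := 1 / Real.sqrt V with hc
  have hc2 : c ^ 2 = 1 / V := by rw [hc, div_pow, one_pow, Real.sq_sqrt hVpos.le]
  refine ⟨fun x => c * bottleneckTestFun π S x, ?_, ?_⟩
  · have : ∑ x, π x * (c * bottleneckTestFun π S x) = c * ∑ x, π x * bottleneckTestFun π S x := by
      rw [mul_sum]; exact sum_congr rfl fun x _ => by ring
    rw [this, sum_mul_bottleneckTestFun, mul_zero]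
  · have : piInner π (fun x => c * bottleneckTestFun π S x) (fun x => c * bottleneckTestFun π S x) =
        c ^ 2 * piInner π (bottleneckTestFun π S) (bottleneckTestFun π S) := by
      unfold piInner; rw [mul_sum]; exact sum_congr rfl fun x _ => by ring
    rw [this, piInner_bottleneckTestFun hπ1, ← hV, hc2, one_div, inv_mul_cancel₀ hVpos.ne']

omit [DecidableEq X] in
/-- The Dirichlet form is a continuous function of `f` (a polynomial in finitely many coordinates).
[folklore] -/
private theorem continuous_dirichletForm (π : X → ℝ) (P : Matrix X X ℝ) :
    Continuous fun u : X → ℝ => dirichletForm π P u := by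
  unfold dirichletForm
  refine continuous_const.mul (continuous_finsetSum _ fun x _ => ?_)
  refine continuous_finsetSum _ fun y _ => ?_
  exact continuous_const.mul (((continuous_apply x).sub (continuous_apply y)).pow 2)

omit [DecidableEq X] in
/-- The constraint set `{f ⊥_π 1, ‖f‖_π = 1}` is compact for a positive `π` (closed, and bounded:
`π(x) f(x)² ≤ 1`). [folklore] -/
private theorem isCompact_constraint {π : X → ℝ} (hπ : ∀ x, 0 < π x) :
    IsCompact {f : X → ℝ | ∑ x, π x * f x = 0 ∧ piInner π f f = 1} := by
  have hc1 : Continuous fun f : X → ℝ => ∑ x, π x * f x :=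
    continuous_finsetSum _ fun x _ => continuous_const.mul (continuous_apply x)
  have hc2 : Continuous fun f : X → ℝ => piInner π f f := by
    unfold piInner
    exact continuous_finsetSum _ fun x _ =>
      continuous_const.mul ((continuous_apply x).mul (continuous_apply x))
  have hclosed : IsClosed {f : X → ℝ | ∑ x, π x * f x = 0 ∧ piInner π f f = 1} := by
    rw [Set.setOf_and]
    exact (isClosed_eq hc1 continuous_const).inter (isClosed_eq hc2 continuous_const)
  -- bound: `|f x| ≤ 1 + 1/π x ≤ 1 + Σ_y 1/π y`
  set R : ℝ := 1 + ∑ y, 1 / π y with hR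
  have hR0 : 0 ≤ R := add_nonneg zero_le_one (sum_nonneg fun y _ => (one_div_pos.mpr (hπ y)).le)
  have hbdd : Bornology.IsBounded {f : X → ℝ | ∑ x, π x * f x = 0 ∧ piInner π f f = 1} := by
    rw [Metric.isBounded_iff_subset_closedBall (0 : X → ℝ)]
    refine ⟨R, fun f hf => ?_⟩
    rw [mem_closedBall_zero_iff, pi_norm_le_iff_of_nonneg hR0]
    intro x
    rw [Real.norm_eq_abs]
    have h1 : π x * (f x * f x) ≤ 1 := by
      have := hf.2
      unfold piInner at this
      rw [← this]
      exact single_le_sum (f := fun y => π y * (f y * f y))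
        (fun y _ => mul_nonneg (hπ y).le (mul_self_nonneg _)) (mem_univ x)
    have h2 : f x * f x ≤ 1 / π x := by
      rw [le_div_iff₀ (hπ x)]; linarith [h1]
    have h3 : 1 / π x ≤ ∑ y, 1 / π y :=
      single_le_sum (f := fun y => 1 / π y) (fun y _ => (one_div_pos.mpr (hπ y)).le) (mem_univ x)
    -- `|f x| ≤ max(1, f x²) ≤ 1 + 1/π x`
    rcases le_or_gt |f x| 1 with h4 | h4
    · linarith [h4, (one_div_pos.mpr (hπ x)).le]
    · have h5 : |f x| ≤ |f x| * |f x| := le_mul_of_one_le_right (abs_nonneg _) h4.le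
      rw [abs_mul_abs_self] at h5
      linarith
  exact Metric.isCompact_of_isClosed_isBounded hclosed hbdd

omit [DecidableEq X] in
/-- The infimum `Gap_R = inf{𝓔(f) : f ⊥_π 1, ‖f‖_π = 1}` is ATTAINED for a positive `π` on a space
with two points: some admissible `g` has `𝓔(g) ≤ 𝓔(f)` for every admissible `f`.
[cite: LevinPeres2017, §13.2.1 Lemma 13.7 eq. (13.3) ("`γ = min …`")] -/
theorem exists_isMinOn_dirichletForm [Nontrivial X] {π : X → ℝ} (hπ : ∀ x, 0 < π x)
    (hπ1 : ∑ x, π x = 1) (P : Matrix X X ℝ) :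
    ∃ g : X → ℝ, (∑ x, π x * g x = 0 ∧ piInner π g g = 1) ∧
      ∀ f : X → ℝ, ∑ x, π x * f x = 0 → piInner π f f = 1 →
        dirichletForm π P g ≤ dirichletForm π P f := by
  classical
  have hne : {f : X → ℝ | ∑ x, π x * f x = 0 ∧ piInner π f f = 1}.Nonempty :=
    exists_mean_zero_piInner_one hπ1 (exists_mass_le_half hπ hπ1)
  obtain ⟨g, hg, hmin⟩ := (isCompact_constraint hπ).exists_isMinOn hne
    (continuous_dirichletForm π P).continuousOn
  refine ⟨g, hg, fun f hf0 hf1 => ?_⟩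
  exact hmin (show f ∈ {f : X → ℝ | ∑ x, π x * f x = 0 ∧ piInner π f f = 1} from ⟨hf0, hf1⟩)

/-! ## A minimiser is an eigenfunction -/

omit [DecidableEq X] in
/-- Second-order expansion of the Dirichlet form along a line:
`𝓔(f + th) = 𝓔(f) + t·Σ_{x,y} π(x)P(x,y)[f(x)−f(y)][h(x)−h(y)] + t²𝓔(h)`. [folklore] -/
private theorem dirichletForm_add_smul (π : X → ℝ) (P : Matrix X X ℝ) (f h : X → ℝ) (t : ℝ) :
    dirichletForm π P (fun x => f x + t * h x) = dirichletForm π P f +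
      t * (∑ x, ∑ y, π x * P x y * ((f x - f y) * (h x - h y))) + t ^ 2 * dirichletForm π P h := by
  unfold dirichletForm
  have h1 : ∀ x y, π x * P x y * ((f x + t * h x) - (f y + t * h y)) ^ 2 =
      π x * P x y * (f x - f y) ^ 2 + (2 * t) * (π x * P x y * ((f x - f y) * (h x - h y))) +
        t ^ 2 * (π x * P x y * (h x - h y) ^ 2) := fun x y => by ring
  simp_rw [h1, sum_add_distrib, ← mul_sum]
  ring

omit [DecidableEq X] in
/-- The polarised Dirichlet form of a REVERSIBLE `P`:
`Σ_{x,y} π(x)P(x,y)[f(x)−f(y)][h(x)−h(y)] = 2⟨(I−P)f, h⟩_π = 2(⟨f,h⟩_π − ⟨Pf,h⟩_π)` (Lemma 13.6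
polarised; reversibility `π(x)P(x,y) = π(y)P(y,x)` is used on one cross term).
[cite: LevinPeres2017, §13.2.1 Lemma 13.6 (`𝓔(f,h) := ⟨(I−P)f,h⟩_π`, `𝓔(f) = 𝓔(f,f)`)] -/
theorem sum_sum_mul_sub_mul_sub {π : X → ℝ} {P : Matrix X X ℝ} (hP : IsRowStochastic P)
    (hDB : DetailedBalance π P) (f h : X → ℝ) :
    ∑ x, ∑ y, π x * P x y * ((f x - f y) * (h x - h y)) =
      2 * (piInner π f h - piInner π (P *ᵥ f) h) := by
  have hst : IsStationary π P := hDB.isStationary hP.2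
  have S1 : ∑ x, ∑ y, π x * P x y * (f x * h x) = piInner π f h := by
    unfold piInner
    refine sum_congr rfl fun x _ => ?_
    have : ∑ y, π x * P x y * (f x * h x) = π x * (f x * h x) * ∑ y, P x y := by
      rw [mul_sum]; exact sum_congr rfl fun y _ => by ring
    rw [this, hP.2 x, mul_one]
  have S4 : ∑ x, ∑ y, π x * P x y * (f y * h y) = piInner π f h := by
    unfold piInner
    rw [sum_comm]
    refine sum_congr rfl fun y _ => ?_
    rw [← sum_mul, hst y]
  have S3 : ∑ x, ∑ y, π x * P x y * (f y * h x) = piInner π (P *ᵥ f) h := by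
    unfold piInner
    refine sum_congr rfl fun x _ => ?_
    rw [mulVec_apply'', sum_mul, mul_sum]
    exact sum_congr rfl fun y _ => by ring
  have S2 : ∑ x, ∑ y, π x * P x y * (f x * h y) = piInner π (P *ᵥ f) h := by
    have : ∑ x, ∑ y, π x * P x y * (f x * h y) = ∑ x, ∑ y, π y * P y x * (f x * h y) :=
      sum_congr rfl fun x _ => sum_congr rfl fun y _ => by rw [hDB x y]
    rw [this, sum_comm]
    unfold piInner
    refine sum_congr rfl fun y _ => ?_
    rw [mulVec_apply'', sum_mul, mul_sum]
    exact sum_congr rfl fun x _ => by ring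
  have h1 : ∀ x y, π x * P x y * ((f x - f y) * (h x - h y)) =
      π x * P x y * (f x * h x) - π x * P x y * (f x * h y) - π x * P x y * (f y * h x) +
        π x * P x y * (f y * h y) := fun x y => by ring
  simp_rw [h1, sum_add_distrib, sum_sub_distrib]
  rw [S1, S2, S3, S4]
  ring

omit [Fintype X] [DecidableEq X] in
/-- If `t·b + t²·c ≥ 0` for every real `t` (with `c ≥ 0`), then `b = 0`. [folklore] -/
private theorem eq_zero_of_forall_le_quadratic {b c : ℝ} (hc : 0 ≤ c)
    (h : ∀ t : ℝ, 0 ≤ t * b + t ^ 2 * c) : b = 0 := by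
  by_contra hb
  have hc1 : 0 < c + 1 := by linarith
  have key := h (-b / (2 * (c + 1)))
  have hcalc : (-b / (2 * (c + 1))) * b + (-b / (2 * (c + 1))) ^ 2 * c =
      -(b ^ 2 * (c + 2)) / (4 * (c + 1) ^ 2) := by
    field_simp
    ring
  rw [hcalc] at key
  have hb2 : 0 < b ^ 2 := lt_of_le_of_ne (sq_nonneg b) (Ne.symm (pow_ne_zero 2 hb))
  have : -(b ^ 2 * (c + 2)) / (4 * (c + 1) ^ 2) < 0 :=
    div_neg_of_neg_of_pos (by nlinarith) (by positivity)
  linarith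

omit [DecidableEq X] in
/-- The homogeneity step "`f̃ := f/‖f‖₂` satisfies `‖f̃‖₂ = 1` and `𝓔(f̃) = 𝓔(f)/‖f‖₂²`": if `g`
minimises `𝓔` over `{f ⊥_π 1, ‖f‖_π = 1}`, then `𝓔(g)·‖h‖²_π ≤ 𝓔(h)` for EVERY `h ⊥_π 1` (for
`π ≥ 0`, `P ≥ 0`). [cite: LevinPeres2017, §13.2.1 Lemma 13.7 (proof, second equality in (13.3))] -/
theorem dirichletForm_mul_piInner_le_of_isMinOn {π : X → ℝ} (hπ0 : ∀ x, 0 ≤ π x)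
    {P : Matrix X X ℝ} (hP0 : ∀ x y, 0 ≤ P x y) {g : X → ℝ}
    (hmin : ∀ f : X → ℝ, ∑ x, π x * f x = 0 → piInner π f f = 1 →
      dirichletForm π P g ≤ dirichletForm π P f)
    {h : X → ℝ} (hh0 : ∑ x, π x * h x = 0) :
    dirichletForm π P g * piInner π h h ≤ dirichletForm π P h := by
  have hI0 : 0 ≤ piInner π h h := sum_nonneg fun x _ => mul_nonneg (hπ0 x) (mul_self_nonneg _)
  rcases hI0.eq_or_lt with hI | hI
  · rw [← hI, mul_zero]; exact dirichletForm_nonneg hπ0 hP0 h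
  · set r : ℝ := piInner π h h with hr
    set s : ℝ := 1 / Real.sqrt r with hs
    have hs2 : s ^ 2 = 1 / r := by rw [hs, div_pow, one_pow, Real.sq_sqrt hI.le]
    have hf0 : ∑ x, π x * (s * h x) = 0 := by
      have : ∑ x, π x * (s * h x) = s * ∑ x, π x * h x := by
        rw [mul_sum]; exact sum_congr rfl fun x _ => by ring
      rw [this, hh0, mul_zero]
    have hf1 : piInner π (fun x => s * h x) (fun x => s * h x) = 1 := by
      have : piInner π (fun x => s * h x) (fun x => s * h x) = s ^ 2 * piInner π h h := by
        unfold piInner; rw [mul_sum]; exact sum_congr rfl fun x _ => by ring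
      rw [this, ← hr, hs2, one_div, inv_mul_cancel₀ hI.ne']
    have h1 := hmin (fun x => s * h x) hf0 hf1
    rw [dirichletForm_const_mul, hs2] at h1
    -- `𝓔(g) ≤ 𝓔(h)/r`
    calc dirichletForm π P g * r ≤ (1 / r * dirichletForm π P h) * r :=
          mul_le_mul_of_nonneg_right h1 hI.le
      _ = dirichletForm π P h := by field_simp

omit [DecidableEq X] in
/-- **A minimiser of `𝓔` on `{f ⊥_π 1, ‖f‖_π = 1}` is an eigenfunction: `Pg = (1 − 𝓔(g))·g`**, for a
row-stochastic `P` reversible with respect to a positive probability vector `π`.  First-order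
condition: for `h ⊥_π 1` and real `t`, `0 ≤ 𝓔(g + th) − 𝓔(g)‖g + th‖²_π = t·[2⟨(I−P)g,h⟩_π −
2𝓔(g)⟨g,h⟩_π] + t²·[𝓔(h) − 𝓔(g)‖h‖²_π]`, so the bracket linear in `t` vanishes; with `h = 1` it
vanishes by stationarity; hence `(I−P)g − 𝓔(g)g ⊥_π` everything, and `π > 0` gives `0`.
[cite: LevinPeres2017, §13.2.1 Lemma 13.7 (proof: the minimum `1 − λ₂` in (13.3) is attained at the
eigenfunction `f₂`, `Pf₂ = λ₂f₂`)] -/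
theorem mulVec_eq_smul_of_isMinOn {π : X → ℝ} (hπ : ∀ x, 0 < π x)
    {P : Matrix X X ℝ} (hP : IsRowStochastic P) (hDB : DetailedBalance π P) {g : X → ℝ}
    (hg0 : ∑ x, π x * g x = 0) (hg1 : piInner π g g = 1)
    (hmin : ∀ f : X → ℝ, ∑ x, π x * f x = 0 → piInner π f f = 1 →
      dirichletForm π P g ≤ dirichletForm π P f) :
    P *ᵥ g = (1 - dirichletForm π P g) • g := by
  have hπ0 : ∀ x, 0 ≤ π x := fun x => (hπ x).le
  have hst : IsStationary π P := hDB.isStationary hP.2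
  set G := dirichletForm π P g with hG
  -- `w = (I − P)g − G g`
  set w : X → ℝ := fun x => g x - (P *ᵥ g) x - G * g x with hw
  -- (1) `⟨w, h⟩_π = 0` for every `h ⊥_π 1`
  have horth : ∀ h : X → ℝ, ∑ x, π x * h x = 0 → piInner π w h = 0 := by
    intro h hh0
    -- the quadratic in `t`
    have hquad : ∀ t : ℝ, 0 ≤ t * (2 * (piInner π g h - piInner π (P *ᵥ g) h) -
        2 * G * piInner π g h) + t ^ 2 * (dirichletForm π P h - G * piInner π h h) := by
      intro t
      have hsum0 : ∑ x, π x * (g x + t * h x) = 0 := by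
        have : ∑ x, π x * (g x + t * h x) = ∑ x, π x * g x + t * ∑ x, π x * h x := by
          rw [mul_sum, ← sum_add_distrib]; exact sum_congr rfl fun x _ => by ring
        rw [this, hg0, hh0, mul_zero, add_zero]
      have h1 := dirichletForm_mul_piInner_le_of_isMinOn hπ0 hP.1 hmin hsum0
      rw [dirichletForm_add_smul, sum_sum_mul_sub_mul_sub hP hDB] at h1
      have hI : piInner π (fun x => g x + t * h x) (fun x => g x + t * h x) =
          1 + 2 * t * piInner π g h + t ^ 2 * piInner π h h := by
        rw [← hg1]
        unfold piInner
        simp_rw [mul_sum, ← sum_add_distrib]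
        exact sum_congr rfl fun x _ => by ring
      rw [hI, ← hG] at h1
      nlinarith [h1]
    have hc : 0 ≤ dirichletForm π P h - G * piInner π h h := by
      have := dirichletForm_mul_piInner_le_of_isMinOn hπ0 hP.1 hmin hh0
      rw [← hG] at this; linarith
    have hb := eq_zero_of_forall_le_quadratic hc hquad
    -- `⟨w,h⟩ = ⟨g,h⟩ − ⟨Pg,h⟩ − G⟨g,h⟩`
    have hwh : piInner π w h = piInner π g h - piInner π (P *ᵥ g) h - G * piInner π g h := by
      unfold piInner
      simp_rw [hw]
      rw [mul_sum, ← sum_sub_distrib, ← sum_sub_distrib]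
      exact sum_congr rfl fun x _ => by ring
    rw [hwh]; linarith
  -- (2) `⟨w, 1⟩_π = Σ π w = 0` by stationarity
  have hw1 : ∑ x, π x * w x = 0 := by
    have hPg : ∑ x, π x * (P *ᵥ g) x = ∑ x, π x * g x := by
      simp_rw [mulVec_apply'', mul_sum]
      rw [sum_comm]
      refine sum_congr rfl fun y _ => ?_
      have : ∑ x, π x * (P x y * g y) = (∑ x, π x * P x y) * g y := by
        rw [sum_mul]; exact sum_congr rfl fun x _ => by ring
      rw [this, hst y]
    have : ∑ x, π x * w x = ∑ x, π x * g x - ∑ x, π x * (P *ᵥ g) x - G * ∑ x, π x * g x := by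
      rw [mul_sum, ← sum_sub_distrib, ← sum_sub_distrib]
      exact sum_congr rfl fun x _ => by simp only [hw]; ring
    rw [this, hPg, hg0]; ring
  -- (3) hence `⟨w, w⟩_π = 0` and `w = 0`
  have hww : piInner π w w = 0 := horth w hw1
  have hw0 : ∀ x, w x = 0 := by
    intro x
    have hterms : ∀ y ∈ (univ : Finset X), 0 ≤ π y * (w y * w y) :=
      fun y _ => mul_nonneg (hπ0 y) (mul_self_nonneg _)
    have h0 := (sum_eq_zero_iff_of_nonneg hterms).mp hww x (mem_univ x)
    rcases mul_eq_zero.mp h0 with h | h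
    · exact absurd h (hπ x).ne'
    · exact mul_self_eq_zero.mp h
  funext x
  have := hw0 x
  simp only [hw] at this
  rw [Pi.smul_apply, smul_eq_mul]
  linarith

/-! ## Lemma 13.7 -/

omit [DecidableEq X] in
/-- `𝓔(f) = (1 − λ)‖f‖²_π` for an eigenfunction `Pf = λf` (row-stochastic `P`, `πP = π`), by
Lemma 13.6 `𝓔(f) = ⟨f,f⟩_π − ⟨f,Pf⟩_π`. [cite: LevinPeres2017, §13.2.1 Lemma 13.7 (proof:
"`⟨(I−P)f,f⟩_π = Σ a_j²(1 − λ_j)`")] -/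
theorem dirichletForm_eq_of_eigen {π : X → ℝ} {P : Matrix X X ℝ} (hP : IsRowStochastic P)
    (hst : IsStationary π P) {f : X → ℝ} {lam : ℝ} (hf : P *ᵥ f = lam • f) :
    dirichletForm π P f = (1 - lam) * piInner π f f := by
  rw [dirichletForm_eq hP hst, hf]
  unfold piInner
  rw [mul_sum, ← sum_sub_distrib]
  exact sum_congr rfl fun x _ => by rw [Pi.smul_apply, smul_eq_mul]; ring

omit [DecidableEq X] in
/-- Every eigenvalue with an eigenfunction `⊥_π 1` is at most `1 − Gap_R`: normalising the
eigenfunction gives an admissible `f̃` with `𝓔(f̃) = 1 − λ` ("`⟨(I−P)f,f⟩_π ≥ 1 − λ₂`" read for a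
single eigenfunction), for `π > 0`, `P` row-stochastic with `πP = π`.
[cite: LevinPeres2017, §13.2.1 Lemma 13.7 (proof)] -/
theorem le_of_mem_orthEigenvalues {π : X → ℝ} (hπ : ∀ x, 0 < π x) {P : Matrix X X ℝ}
    (hP : IsRowStochastic P) (hst : IsStationary π P) {lam : ℝ}
    (hlam : lam ∈ orthEigenvalues π P) : lam ≤ 1 - spectralGapR π P := by
  obtain ⟨f, hfne, hf0, hf⟩ := hlam
  have hπ0 : ∀ x, 0 ≤ π x := fun x => (hπ x).le
  -- `‖f‖²_π > 0`
  have hI : 0 < piInner π f f := by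
    have hI0 : 0 ≤ piInner π f f := sum_nonneg fun x _ => mul_nonneg (hπ0 x) (mul_self_nonneg _)
    rcases hI0.eq_or_lt with h | h
    · exfalso
      apply hfne
      funext x
      have hterms : ∀ y ∈ (univ : Finset X), 0 ≤ π y * (f y * f y) :=
        fun y _ => mul_nonneg (hπ0 y) (mul_self_nonneg _)
      have h0 := (sum_eq_zero_iff_of_nonneg hterms).mp h.symm x (mem_univ x)
      rcases mul_eq_zero.mp h0 with h' | h'
      · exact absurd h' (hπ x).ne'
      · exact mul_self_eq_zero.mp h'
    · exact h
  set r : ℝ := piInner π f f with hr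
  set s : ℝ := 1 / Real.sqrt r with hs
  have hs2 : s ^ 2 = 1 / r := by rw [hs, div_pow, one_pow, Real.sq_sqrt hI.le]
  have hg0 : ∑ x, π x * (s * f x) = 0 := by
    have : ∑ x, π x * (s * f x) = s * ∑ x, π x * f x := by
      rw [mul_sum]; exact sum_congr rfl fun x _ => by ring
    rw [this, hf0, mul_zero]
  have hg1 : piInner π (fun x => s * f x) (fun x => s * f x) = 1 := by
    have : piInner π (fun x => s * f x) (fun x => s * f x) = s ^ 2 * piInner π f f := by
      unfold piInner; rw [mul_sum]; exact sum_congr rfl fun x _ => by ring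
    rw [this, ← hr, hs2, one_div, inv_mul_cancel₀ hI.ne']
  have hle := spectralGapR_le_dirichletForm hπ0 hP.1 hg0 hg1
  rw [dirichletForm_const_mul, dirichletForm_eq_of_eigen hP hst hf, ← hr, hs2] at hle
  have : 1 / r * ((1 - lam) * r) = 1 - lam := by field_simp
  rw [this] at hle
  linarith

omit [DecidableEq X] in
/-- There is an admissible EIGENFUNCTION realising the gap: `g ⊥_π 1`, `‖g‖_π = 1`,
`𝓔(g) = Gap_R`, `Pg = (1 − Gap_R)g` (reversible `P`, positive `π`, `|X| ≥ 2`).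
[cite: LevinPeres2017, §13.2.1 Lemma 13.7 (proof: the eigenfunction `f₂`)] -/
theorem exists_eigenfunction_spectralGapR [Nontrivial X] {π : X → ℝ} (hπ : ∀ x, 0 < π x)
    (hπ1 : ∑ x, π x = 1) {P : Matrix X X ℝ} (hP : IsRowStochastic P) (hDB : DetailedBalance π P) :
    ∃ g : X → ℝ, ∑ x, π x * g x = 0 ∧ piInner π g g = 1 ∧
      dirichletForm π P g = spectralGapR π P ∧ P *ᵥ g = (1 - spectralGapR π P) • g := by
  have hπ0 : ∀ x, 0 ≤ π x := fun x => (hπ x).le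
  obtain ⟨g, ⟨hg0, hg1⟩, hmin⟩ := exists_isMinOn_dirichletForm hπ hπ1 P
  have hE : dirichletForm π P g = spectralGapR π P := by
    refine le_antisymm ?_ (spectralGapR_le_dirichletForm hπ0 hP.1 hg0 hg1)
    refine le_csInf ⟨_, ⟨g, ⟨hg0, hg1⟩, rfl⟩⟩ ?_
    rintro _ ⟨f, ⟨hf0, hf1⟩, rfl⟩
    exact hmin f hf0 hf1
  refine ⟨g, hg0, hg1, hE, ?_⟩
  rw [← hE]
  exact mulVec_eq_smul_of_isMinOn hπ hP hDB hg0 hg1 hmin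

omit [DecidableEq X] in
/-- `1 − Gap_R` is the LARGEST eigenvalue of `P` with an eigenfunction `⊥_π 1` (reversible `P`,
positive `π`, `|X| ≥ 2`). [cite: LevinPeres2017, §13.2.1 Lemma 13.7] -/
theorem isGreatest_orthEigenvalues [Nontrivial X] {π : X → ℝ} (hπ : ∀ x, 0 < π x)
    (hπ1 : ∑ x, π x = 1) {P : Matrix X X ℝ} (hP : IsRowStochastic P) (hDB : DetailedBalance π P) :
    IsGreatest (orthEigenvalues π P) (1 - spectralGapR π P) := by
  refine ⟨?_, fun lam hlam => le_of_mem_orthEigenvalues hπ hP (hDB.isStationary hP.2) hlam⟩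
  obtain ⟨g, hg0, hg1, -, hPg⟩ := exists_eigenfunction_spectralGapR hπ hπ1 hP hDB
  refine ⟨g, ?_, hg0, hPg⟩
  intro hg
  rw [hg] at hg1
  unfold piInner at hg1
  simp at hg1

omit [DecidableEq X] in
/-- **Lemma 13.7.**  For the transition matrix `P` of a reversible Markov chain (positive
stationary `π`, `|X| ≥ 2`), the spectral gap `γ = 1 − λ₂` satisfies
`γ = min{𝓔(f) : f ⊥_π 1, ‖f‖₂ = 1}` — in the tree's vocabulary `spectralGap π P = spectralGapR π P`
(`= Gap_R`, Andrieu–Vihola's right spectral gap of `PeskunOrdering.lean`).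
[cite: LevinPeres2017, §13.2.1 Lemma 13.7 eq. (13.3)] -/
theorem LevinPeres2017_lemma_13_7 [Nontrivial X] {π : X → ℝ} (hπ : ∀ x, 0 < π x)
    (hπ1 : ∑ x, π x = 1) {P : Matrix X X ℝ} (hP : IsRowStochastic P) (hDB : DetailedBalance π P) :
    spectralGap π P = spectralGapR π P := by
  unfold spectralGap secondEigenvalue
  rw [(isGreatest_orthEigenvalues hπ hπ1 hP hDB).csSup_eq]
  ring

omit [DecidableEq X] in
/-- Lemma 13.7, the minimum is attained: `γ` is the LEAST element of `{𝓔(f) : f ⊥_π 1, ‖f‖_π = 1}`.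
[cite: LevinPeres2017, §13.2.1 Lemma 13.7 eq. (13.3) (first equality, "`min`")] -/
theorem LevinPeres2017_lemma_13_7_isLeast [Nontrivial X] {π : X → ℝ} (hπ : ∀ x, 0 < π x)
    (hπ1 : ∑ x, π x = 1) {P : Matrix X X ℝ} (hP : IsRowStochastic P) (hDB : DetailedBalance π P) :
    IsLeast ((fun f => dirichletForm π P f) ''
      {f : X → ℝ | ∑ x, π x * f x = 0 ∧ piInner π f f = 1}) (spectralGap π P) := by
  rw [LevinPeres2017_lemma_13_7 hπ hπ1 hP hDB]
  obtain ⟨g, hg0, hg1, hE, -⟩ := exists_eigenfunction_spectralGapR hπ hπ1 hP hDB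
  refine ⟨⟨g, ⟨hg0, hg1⟩, hE⟩, ?_⟩
  rintro _ ⟨f, ⟨hf0, hf1⟩, rfl⟩
  exact spectralGapR_le_dirichletForm (fun x => (hπ x).le) hP.1 hf0 hf1

omit [DecidableEq X] in
/-- Lemma 13.7, second form: `γ‖f‖²_π ≤ 𝓔(f)` for EVERY `f ⊥_π 1`, i.e. `γ = min_{f ⊥_π 1, f ≢ 0}
𝓔(f)/‖f‖₂²` (the bound; attainment is `exists_eigenfunction_spectralGap`).
[cite: LevinPeres2017, §13.2.1 Lemma 13.7 eq. (13.3) (second equality)] -/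
theorem LevinPeres2017_lemma_13_7_rayleigh [Nontrivial X] {π : X → ℝ} (hπ : ∀ x, 0 < π x)
    (hπ1 : ∑ x, π x = 1) {P : Matrix X X ℝ} (hP : IsRowStochastic P) (hDB : DetailedBalance π P)
    {f : X → ℝ} (hf0 : ∑ x, π x * f x = 0) :
    spectralGap π P * piInner π f f ≤ dirichletForm π P f := by
  obtain ⟨g, ⟨hg0, hg1⟩, hmin⟩ := exists_isMinOn_dirichletForm hπ hπ1 P
  have hEg : dirichletForm π P g = spectralGap π P := by
    rw [LevinPeres2017_lemma_13_7 hπ hπ1 hP hDB]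
    refine le_antisymm ?_ (spectralGapR_le_dirichletForm (fun x => (hπ x).le) hP.1 hg0 hg1)
    refine le_csInf ⟨_, ⟨g, ⟨hg0, hg1⟩, rfl⟩⟩ ?_
    rintro _ ⟨f', ⟨hf0', hf1'⟩, rfl⟩
    exact hmin f' hf0' hf1'
  rw [← hEg]
  exact dirichletForm_mul_piInner_le_of_isMinOn (fun x => (hπ x).le) hP.1 hmin hf0

omit [DecidableEq X] in
/-- The gap is realised by an eigenfunction: some `g ⊥_π 1` with `‖g‖_π = 1` has `Pg = λ₂ g` and
`𝓔(g) = γ`. [cite: LevinPeres2017, §13.2.1 Lemma 13.7 (proof: `f₂`) with §12.2 eq. (12.7)] -/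
theorem exists_eigenfunction_spectralGap [Nontrivial X] {π : X → ℝ} (hπ : ∀ x, 0 < π x)
    (hπ1 : ∑ x, π x = 1) {P : Matrix X X ℝ} (hP : IsRowStochastic P) (hDB : DetailedBalance π P) :
    ∃ g : X → ℝ, ∑ x, π x * g x = 0 ∧ piInner π g g = 1 ∧
      dirichletForm π P g = spectralGap π P ∧ P *ᵥ g = secondEigenvalue π P • g := by
  obtain ⟨g, hg0, hg1, hE, hPg⟩ := exists_eigenfunction_spectralGapR hπ hπ1 hP hDB
  have h137 := LevinPeres2017_lemma_13_7 hπ hπ1 hP hDB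
  refine ⟨g, hg0, hg1, by rw [h137]; exact hE, ?_⟩
  have : secondEigenvalue π P = 1 - spectralGapR π P := by
    unfold spectralGap at h137; linarith
  rw [this]; exact hPg

omit [DecidableEq X] in
/-- **Remark 13.8**: `γ·Var_π(f) ≤ 𝓔(f)` for EVERY `f`, i.e. `γ = min_{Var_π(f) ≠ 0} 𝓔(f)/Var_π(f)`
(the bound for all `f`; `𝓔(f) = 𝓔(f − E_π f)` and `f − E_π f ⊥_π 1`).
[cite: LevinPeres2017, §13.2.1 Remark 13.8] -/
theorem LevinPeres2017_remark_13_8 [Nontrivial X] {π : X → ℝ} (hπ : ∀ x, 0 < π x)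
    (hπ1 : ∑ x, π x = 1) {P : Matrix X X ℝ} (hP : IsRowStochastic P) (hDB : DetailedBalance π P)
    (f : X → ℝ) : spectralGap π P * lawVariance π f ≤ dirichletForm π P f := by
  have h := LevinPeres2017_lemma_13_7_rayleigh hπ hπ1 hP hDB (f := fun x => f x - lawMean π f)
    (sum_mul_sub_lawMean hπ1 f)
  rwa [piInner_centred_eq_lawVariance, dirichletForm_sub_const] at h

/-! ## Theorem 13.10 as printed -/

/-- **Theorem 13.10 (Sinclair and Jerrum (1989), Lawler and Sokal (1988)).**  Let `λ₂` be the second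
largest eigenvalue of a reversible transition matrix `P` (positive stationary `π`, `|X| ≥ 2`), and
let `γ = 1 − λ₂`.  Then **`Φ⋆²/2 ≤ γ ≤ 2Φ⋆`**.  (Lemma 13.7 `γ = Gap_R` applied to the two halves
typed for the variational gap in `CheegerInequality.lean` / `BottleneckRatioSpectralGap.lean`.)
[cite: LevinPeres2017, §13.2.2 Thm 13.10 eq. (13.6)] -/
theorem LevinPeres2017_thm_13_10 [Nontrivial X] {π : X → ℝ} (hπ : ∀ x, 0 < π x)
    (hπ1 : ∑ x, π x = 1) {P : Matrix X X ℝ} (hP : IsRowStochastic P) (hDB : DetailedBalance π P) :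
    bottleneckRatioStar π P ^ 2 / 2 ≤ spectralGap π P ∧
      spectralGap π P ≤ 2 * bottleneckRatioStar π P := by
  rw [LevinPeres2017_lemma_13_7 hπ hπ1 hP hDB]
  have hπ0 : ∀ x, 0 ≤ π x := fun x => (hπ x).le
  have hst : IsStationary π P := hDB.isStationary hP.2
  exact LevinPeres2017_thm_13_10_gapR hP hst hπ0 hπ1 (exists_mass_le_half hπ hπ1)

end Literature.Probability.MarkovChains
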